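import Mathlib.RingTheory.Nullstellensatz
import Mathlib.FieldTheory.IsAlgClosed.Basic
import Mathlib.NumberTheory.NumberField.Basic
import Mathlib.RingTheory.DedekindDomain.AdicValuation
import Mathlib.RingTheory.Localization.Integer
import Mathlib.Algebra.Algebra.Operations
import Mathlib.Algebra.Group.Pointwise.Set.ListOfFn

/-!
# Good-prime localisation on an affine curve (support lemma for [GenEll] Thm 2.1, route item GenEllTwo)

A purely algebraic «matching lemma» used by every sharp form of [GenEll] Proposition 1.6
(conductor bounded by the height) on a FIXED affine curve: let `K` be a number field,
`f, G ∈ K[X_i : i ∈ σ]` (`σ` finite) and let `Δ ⊆ K^σ` be a finite set containing every common zero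
of `f` and `G` with coordinates in some algebraically closed field `Ω ⊇ K`.  Then there is ONE nonzero
`d ∈ 𝓞 K` («the bad primes divide `d`») such that for every field `L ⊇ K`, every valuation `v` on
`L` which is `≤ 1` on `𝓞 K` and satisfies `v d = 1` («a good prime»), and every `v`-integral point
`y ∈ L^σ` with `f(y) = 0` and `v (G y) < 1` («`y` lies on the curve and meets `V(G)` at `v`»), there is
an ACTUAL point `P ∈ Δ` with `v (y_i - P_i) < 1` for all `i` («`y` reduces onto `P`»).

Proof: Hilbert's Nullstellensatz in Mathlib's relative form
(`MvPolynomial.vanishingIdeal_zeroLocus_eq_radical`, coefficients in `K`, points in `Ω`) applied,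
for EVERY choice function `c : Δ → σ`, to the product `∏_{P ∈ Δ} (X_{c P} − P_{c P})`, which vanishes
on `V(f, G)(Ω) ⊆ Δ`; hence a power of it equals `A·f + B·G`.  One denominator `d` clears the
coefficients of all the `B`'s (`IsLocalization.exist_integer_multiples_of_finite`, `K = Frac 𝓞 K`).
At a good prime the valuation of the right-hand side at `y` is `< 1`, so some factor of the product
has valuation `< 1`; the pigeonhole over choice functions produces one `P` matching in all
coordinates.  No integrality of `f`, `G` or of the coordinates of `Δ` is needed, and there is no
archimedean input.

Consumers (abc-iut cell, support item GenEllTwo = stmt-ABC-19679; S6 GENELLTWO-P1ROUTE §3 (d) / W5,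
S4 GENELLTWO-PLAN (B5)): with `f` the affine equation of the auxiliary curve (`r^e − x(1−x)` resp.
`u^e + w^e − 1`) and `G` a numerator of `t − b` (resp. a form cutting out a fibre of the Belyi map),
the lemma localises «`y` meets the divisor at `w`» to «`y ≡ P (mod w)` for a point `P` of the
divisor», after which sections vanishing to order `k` at `P` have `ord_w ≥ k` at `y`.
Everything here is classical commutative algebra; nothing in this file refers to, or takes a side on,
any disputed claim.  References for the surrounding argument: [GenEll] = S. Mochizuki, *Arithmetic
elliptic curves in general position*, Math. J. Okayama Univ. 52 (2010), Prop. 1.6, Thm. 2.1;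
E. Bombieri, W. Gubler, *Heights in Diophantine Geometry* (2006), §2.2–2.3 (local Weil functions).
-/

namespace Literature.NumberTheory.DiophantineGeometry.PlaneCurve

open MvPolynomial

universe u v w

/-! ### The algebraic step: Nullstellensatz for the choice-function products -/

section Algebra

variable {K : Type u} [Field K] {σ : Type w}

/-- Evaluation of the «choice product» `∏_{P ∈ Δ} (X_{c P} − P_{c P})` at a point `y` with
coordinates in a `K`-algebra `L`: it is the product of the differences `y_{c P} − P_{c P}`
(file-private plumbing). [folklore] -/
private theorem aeval_prod_X_sub_C {L : Type v} [CommRing L] [Algebra K L] (Δ : Finset (σ → K))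
    (c : Δ → σ) (y : σ → L) :
    aeval y (∏ P : Δ, (X (c P) - C ((P : σ → K) (c P)))) =
      ∏ P : Δ, (y (c P) - algebraMap K L ((P : σ → K) (c P))) := by
  rw [map_prod]
  refine Finset.prod_congr rfl fun P _ => ?_
  simp [map_sub, aeval_X]

/-- **Nullstellensatz step.**  If the finite set `Δ ⊆ K^σ` contains every common zero of `f` and `G`
in an algebraically closed field `Ω ⊇ K`, then for every choice function `c : Δ → σ` some power of the
product `∏_{P ∈ Δ} (X_{c P} − P_{c P})` lies in the ideal `(f, G)` of `K[X]`, i.e. equals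
`A·f + B·G`.  This is Hilbert's Nullstellensatz `I(Z(J)) = √J` applied to `J = (f, G)` and the
product, which vanishes on `Z(J) ⊆ Δ` (Mathlib's relative form
`MvPolynomial.vanishingIdeal_zeroLocus_eq_radical`; cf. the use in Bombieri–Gubler Lemma 2.2.7).
[cite: BombieriGubler2006, A.2.2 (Hilbert's Nullstellensatz), cf. Lemma 2.2.7] -/
theorem exists_pow_prod_eq_of_commonZeros [Finite σ] {Ω : Type*} [Field Ω] [Algebra K Ω]
    [IsAlgClosed Ω] (f G : MvPolynomial σ K) (Δ : Finset (σ → K))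
    (hΔ : ∀ z : σ → Ω, aeval z f = 0 → aeval z G = 0 → ∃ P ∈ Δ, ∀ i, z i = algebraMap K Ω (P i))
    (c : Δ → σ) :
    ∃ (N : ℕ) (A B : MvPolynomial σ K),
      (∏ P : Δ, (X (c P) - C ((P : σ → K) (c P)))) ^ N = A * f + B * G := by
  classical
  set I : Ideal (MvPolynomial σ K) := Ideal.span {f, G} with hI
  have hfI : f ∈ I := Ideal.subset_span (by simp)
  have hGI : G ∈ I := Ideal.subset_span (by simp)
  have hmem : (∏ P : Δ, (X (c P) - C ((P : σ → K) (c P)))) ∈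
      vanishingIdeal K (zeroLocus Ω I) := by
    rw [mem_vanishingIdeal_iff]
    intro z hz
    rw [mem_zeroLocus_iff] at hz
    obtain ⟨P, hP, hzP⟩ := hΔ z (hz f hfI) (hz G hGI)
    rw [aeval_prod_X_sub_C]
    exact Finset.prod_eq_zero (Finset.mem_univ ⟨P, hP⟩) (by simp [hzP (c ⟨P, hP⟩)])
  rw [vanishingIdeal_zeroLocus_eq_radical] at hmem
  obtain ⟨N, hN⟩ := hmem
  obtain ⟨A, B, hAB⟩ := Ideal.mem_span_pair.mp hN
  exact ⟨N, A, B, hAB.symm⟩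

end Algebra

/-! ### The valuation step -/

section Valuation

variable {K : Type u} [Field K] {σ : Type w}

/-- A polynomial whose coefficients have valuation `≤ 1` takes values of valuation `≤ 1` at points
all of whose coordinates have valuation `≤ 1`: the non-archimedean case (`δ = 0`, Gauss norm
`|p| ≤ 1`) of the inequality `sup |f(P)| ≤ C^δ |p| max(1, sup max_j |f_j(P)|)^d` of
Bombieri–Gubler, Lemma 2.2.9, display (2.1). [cite: BombieriGubler2006, Lemma 2.2.9 (2.1)] -/
theorem valuation_aeval_le_one {L : Type v} [Field L] [Algebra K L] {Γ₀ : Type*}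
    [LinearOrderedCommMonoidWithZero Γ₀] (v : Valuation L Γ₀) (Q : MvPolynomial σ K)
    (hQ : ∀ m, v (algebraMap K L (coeff m Q)) ≤ 1) (y : σ → L) (hy : ∀ i, v (y i) ≤ 1) :
    v (aeval y Q) ≤ 1 := by
  classical
  rw [MvPolynomial.aeval_def, MvPolynomial.eval₂_eq]
  refine Valuation.map_sum_le v fun m _ => ?_
  rw [Valuation.map_mul, map_prod]
  calc v (algebraMap K L (coeff m Q)) * ∏ i ∈ m.support, v (y i ^ m i)
      ≤ 1 * 1 := by
        refine mul_le_mul' (hQ m) (Finset.prod_le_one' fun i _ => ?_)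
        rw [Valuation.map_pow]
        exact pow_le_one' (hy i) _
    _ = 1 := one_mul 1

/-- **Pigeonhole over choice functions.**  If for every choice function `c : Δ → σ` some factor
`y_{c P} − P_{c P}` (`P ∈ Δ`) has valuation `< 1`, then some `P ∈ Δ` has `v (y_i − P_i) < 1` for ALL
`i` (file-private plumbing). [folklore] -/
private theorem exists_forall_lt_one_of_forall_choice {L : Type v} [Field L] [Algebra K L] {Γ₀ : Type*}
    [LinearOrderedCommMonoidWithZero Γ₀] (v : Valuation L Γ₀) (Δ : Finset (σ → K)) (y : σ → L)
    (h : ∀ c : Δ → σ, ∃ P : Δ, v (y (c P) - algebraMap K L ((P : σ → K) (c P))) < 1) :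
    ∃ P ∈ Δ, ∀ i, v (y i - algebraMap K L (P i)) < 1 := by
  by_contra hcon
  push Not at hcon
  choose c hc using fun P : Δ => hcon P P.2
  obtain ⟨P, hP⟩ := h c
  exact (not_le.mpr hP) (hc P)

end Valuation

/-! ### Clearing denominators over the ring of integers -/

section Denominators

open NumberField

variable {K : Type u} [Field K] [NumberField K] {σ : Type w}

/-- One common denominator for the coefficients of a finite family of polynomials over a number field
`K = Frac (𝓞 K)`: there is `d ∈ 𝓞 K`, `d ≠ 0`, such that every coefficient of every `C d · Q_j` comes
from `𝓞 K` (file-private plumbing). [folklore] -/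
private theorem exists_den_coeff {ι : Type*} [Finite ι] (Q : ι → MvPolynomial σ K) :
    ∃ d : 𝓞 K, d ≠ 0 ∧ ∀ j m, ∃ r : 𝓞 K,
      algebraMap (𝓞 K) K r = algebraMap (𝓞 K) K d * coeff m (Q j) := by
  classical
  -- the finite family of all coefficients of all `Q j`
  let S : Type _ := (j : ι) × ((Q j).support)
  haveI : Finite S := by
    haveI := Fintype.ofFinite ι
    infer_instance
  obtain ⟨b, hb⟩ := IsLocalization.exist_integer_multiples_of_finite (nonZeroDivisors (𝓞 K))
    (fun s : S => coeff (s.2 : σ →₀ ℕ) (Q s.1))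
  refine ⟨(b : 𝓞 K), nonZeroDivisors.coe_ne_zero b, fun j m => ?_⟩
  by_cases hm : m ∈ (Q j).support
  · obtain ⟨r, hr⟩ := hb ⟨j, ⟨m, hm⟩⟩
    refine ⟨r, ?_⟩
    rw [hr, Algebra.smul_def]
  · refine ⟨0, ?_⟩
    rw [MvPolynomial.notMem_support_iff.mp hm, mul_zero, map_zero]

end Denominators

/-! ### The localisation theorem -/

section Main

open NumberField

variable {K : Type u} [Field K] [NumberField K] {σ : Type w} [Fintype σ]
variable {Ω : Type*} [Field Ω] [Algebra K Ω] [IsAlgClosed Ω]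

/-- **Good-prime localisation on an affine curve (valuation form).**  Let `K` be a number field,
`f, G ∈ K[X_σ]` with `σ` finite, and `Δ ⊆ K^σ` a finite set containing all common zeros of `f, G`
in some algebraically closed field `Ω ⊇ K` (e.g. `ℂ`, `ℚ̄`, `AlgebraicClosure K`).  Then there is
a nonzero `d ∈ 𝓞 K` such that: for every field `L ⊇ K` and every valuation
`v` on `L` with `v ≤ 1` on `𝓞 K` and `v d = 1`, every `v`-integral `y ∈ L^σ` with `f(y) = 0` and
`v (G(y)) < 1` satisfies `v (y_i − P_i) < 1` for all `i`, for some `P ∈ Δ`.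
(«At a prime not dividing `d`, a point of the curve `f = 0` that meets `V(G)` reduces onto a point
of `Δ = V(f, G)`.»)  This is the «for almost all `v` the constant is trivial» form
(Bombieri–Gubler Remark 2.2.13: the elements `p_a ∈ K` bounding the Nullstellensatz step depend
only on the geometric data, not on the place) of the Nullstellensatz argument of Bombieri–Gubler
Lemmas 2.2.7/2.2.10; it is the model-free input replacing «the definition involving `(−)_red`» in
the proof of GenEll Prop. 1.6 (Mochizuki 2010) on a fixed affine curve.
[cite: BombieriGubler2006, Lemma 2.2.10 with Remark 2.2.13 (non-archimedean, good reduction)] -/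
theorem exists_den_localisation (f G : MvPolynomial σ K) (Δ : Finset (σ → K))
    (hΔ : ∀ z : σ → Ω, aeval z f = 0 → aeval z G = 0 → ∃ P ∈ Δ, ∀ i, z i = algebraMap K Ω (P i)) :
    ∃ d : 𝓞 K, d ≠ 0 ∧
      ∀ (L : Type v) [Field L] [Algebra K L] (Γ₀ : Type) [LinearOrderedCommGroupWithZero Γ₀]
        (v : Valuation L Γ₀), (∀ r : 𝓞 K, v (algebraMap (𝓞 K) L r) ≤ 1) →
        v (algebraMap (𝓞 K) L d) = 1 →
        ∀ y : σ → L, (∀ i, v (y i) ≤ 1) → aeval y f = 0 → v (aeval y G) < 1 →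
          ∃ P ∈ Δ, ∀ i, v (y i - algebraMap K L (P i)) < 1 := by
  classical
  -- Nullstellensatz for every choice function
  choose N A B hNAB using exists_pow_prod_eq_of_commonZeros f G Δ hΔ
  -- one denominator for all the `B c`
  obtain ⟨d, hd0, hd⟩ := exists_den_coeff B
  refine ⟨d, hd0, ?_⟩
  intro L _ _ Γ₀ _ v hv hvd y hy hf hG
  refine exists_forall_lt_one_of_forall_choice v Δ y fun c => ?_
  -- evaluate `(∏)^N = A f + B G` at `y` and multiply by `d`
  have key := congrArg (aeval y) (hNAB c)
  rw [map_pow, aeval_prod_X_sub_C, map_add, map_mul, map_mul, hf, mul_zero, zero_add] at key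
  -- the polynomial `C d * B c` has `𝓞 K`-integral coefficients
  have hB : v (aeval y (C (algebraMap (𝓞 K) K d) * B c)) ≤ 1 := by
    refine valuation_aeval_le_one v _ (fun m => ?_) y hy
    obtain ⟨r, hr⟩ := hd c m
    rw [coeff_C_mul, ← hr, ← IsScalarTower.algebraMap_apply]
    exact hv r
  have hd1 : v (algebraMap K L (algebraMap (𝓞 K) K d)) = 1 := by
    rw [← IsScalarTower.algebraMap_apply]; exact hvd
  -- valuation of both sides of `d * (∏)^N = (C d * B c)(y) * G(y)`
  have hlt : v (algebraMap K L (algebraMap (𝓞 K) K d)) *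
      v (∏ P : Δ, (y (c P) - algebraMap K L ((P : σ → K) (c P)))) ^ (N c) < 1 := by
    rw [← Valuation.map_pow, ← Valuation.map_mul, key, ← mul_assoc]
    have : algebraMap K L (algebraMap (𝓞 K) K d) * aeval y (B c) =
        aeval y (C (algebraMap (𝓞 K) K d) * B c) := by
      rw [map_mul, aeval_C]
    rw [this, Valuation.map_mul]
    calc v (aeval y (C (algebraMap (𝓞 K) K d) * B c)) * v (aeval y G)
        ≤ 1 * v (aeval y G) := mul_le_mul' hB le_rfl
      _ = v (aeval y G) := one_mul _
      _ < 1 := hG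
  rw [hd1, one_mul, map_prod] at hlt
  -- hence some factor has valuation `< 1`
  by_contra hall
  push Not at hall
  have h1 : (1 : Γ₀) ≤ ∏ P : Δ, v (y (c P) - algebraMap K L ((P : σ → K) (c P))) :=
    Finset.one_le_prod' fun P _ => hall P
  exact (not_lt.mpr (one_le_pow_of_one_le' h1 (N c))) hlt

/-- **Good-prime localisation on an affine curve, number-field form.**  As
`exists_den_localisation`, for the finite places `w` of a number field `L ⊇ K`
(`w : HeightOneSpectrum (𝓞 L)`, `w.valuation L`): one nonzero `d ∈ 𝓞 K` such that at every `w`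
with `w(d) = 1`, every `w`-integral point `y` of `f = 0` with `w (G y) < 1` reduces onto a point of
`Δ`. [cite: BombieriGubler2006, Lemma 2.2.10 with Remark 2.2.13 (non-archimedean, good reduction)] -/
theorem exists_den_localisation_finitePlace (f G : MvPolynomial σ K) (Δ : Finset (σ → K))
    (hΔ : ∀ z : σ → Ω, aeval z f = 0 → aeval z G = 0 → ∃ P ∈ Δ, ∀ i, z i = algebraMap K Ω (P i)) :
    ∃ d : 𝓞 K, d ≠ 0 ∧
      ∀ (L : Type v) [Field L] [NumberField L] [Algebra K L]
        (w : IsDedekindDomain.HeightOneSpectrum (𝓞 L)),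
        w.valuation L (algebraMap (𝓞 K) L d) = 1 →
        ∀ y : σ → L, (∀ i, w.valuation L (y i) ≤ 1) → aeval y f = 0 →
          w.valuation L (aeval y G) < 1 →
          ∃ P ∈ Δ, ∀ i, w.valuation L (y i - algebraMap K L (P i)) < 1 := by
  obtain ⟨d, hd0, hd⟩ := exists_den_localisation.{u, v, w} (Ω := Ω) f G Δ hΔ
  refine ⟨d, hd0, fun L _ _ _ w hwd y hy hf hG => hd L _ (w.valuation L) (fun r => ?_) hwd y hy hf hG⟩
  rw [IsScalarTower.algebraMap_apply (𝓞 K) (𝓞 L) L]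
  exact IsDedekindDomain.HeightOneSpectrum.valuation_le_one _ _

end Main

/-! ### Multiplicity at a good prime: sections vanishing to order `k` along the curve -/

section Multiplicity

open NumberField

variable {K : Type u} [Field K] {σ : Type w}

open Pointwise in
/-- Unpacking membership in `(f) + 𝔪_P^k`, where `𝔪_P = (X_i − P_i : i ∈ σ)` is the ideal of the
`K`-point `P`: `R = a·f + ∑_j D_j · ∏_{l < k} (X_{i(j,l)} − P_{i(j,l)})` for finitely many polynomials
`D_j` and index choices `i(j,l)` (file-private plumbing). [folklore] -/
private theorem exists_sum_prod_of_mem_span_sup_pow (f R : MvPolynomial σ K) (P : σ → K) (k : ℕ)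
    (hR : R ∈ Ideal.span {f} ⊔ Ideal.span (Set.range fun i : σ => X i - C (P i)) ^ k) :
    ∃ (a : MvPolynomial σ K) (n : ℕ) (D : Fin n → MvPolynomial σ K) (e : Fin n → Fin k → σ),
      R = a * f + ∑ j, D j * ∏ l, (X (e j l) - C (P (e j l))) := by
  classical
  obtain ⟨a₀, ha₀, b, hb, hab⟩ := Submodule.mem_sup.mp hR
  obtain ⟨a, rfl⟩ := Ideal.mem_span_singleton'.mp ha₀
  set S : Set (MvPolynomial σ K) := Set.range fun i : σ => X i - C (P i) with hS
  rw [show Ideal.span S ^ k = Ideal.span (S ^ k) from Submodule.span_pow S k] at hb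
  obtain ⟨n, D, g, hsum⟩ := Submodule.mem_span_set'.mp hb
  have hg : ∀ j, ∃ e : Fin k → S, (List.ofFn fun l => ((e l : S) : MvPolynomial σ K)).prod =
      (g j : MvPolynomial σ K) := fun j => Set.mem_pow.mp (g j).2
  choose e he using hg
  have hidx : ∀ j l, ∃ i : σ, X i - C (P i) = ((e j l : S) : MvPolynomial σ K) :=
    fun j l => Set.mem_range.mp (e j l).2
  choose idx hidx using hidx
  refine ⟨a, n, D, idx, ?_⟩
  rw [← hab, ← hsum]
  congr 1
  refine Finset.sum_congr rfl fun j _ => ?_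
  rw [smul_eq_mul, ← he j, List.prod_ofFn]
  congr 1
  exact Finset.prod_congr rfl fun l _ => (hidx j l).symm

variable [NumberField K]

/-- **Multiplicity at a good prime.**  Let `R ∈ (f) + 𝔪_P^k ⊆ K[X_σ]` («`R` vanishes to order `≥ k`
at the `K`-point `P` along the hypersurface `f = 0`»).  Then there is a nonzero `d ∈ 𝓞 K` such that
for every field `L ⊇ K`, every valuation `v` on `L` with `v ≤ 1` on `𝓞 K` and `v d = 1`, and every
`v`-integral `y ∈ L^σ` with `f(y) = 0`: if `v (y_i − P_i) ≤ μ` for all `i` then `v (R(y)) ≤ μ^k`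
(«`ord_w R(y) ≥ k · ord_w (y − P)`»).  Combined with `exists_den_localisation` this is the local
input of every sharp form of GenEll Prop. 1.6 (Mochizuki 2010) on a fixed curve; it is again the
«coefficients `p_a` independent of the place» bookkeeping of Bombieri–Gubler Remark 2.2.13 applied
to the Gauss-norm inequality of Lemma 2.2.9 (2.1).
[cite: BombieriGubler2006, Remark 2.2.13 with Lemma 2.2.9 (2.1) (non-archimedean)] -/
theorem exists_den_valuation_le_pow (f R : MvPolynomial σ K) (P : σ → K) (k : ℕ)
    (hR : R ∈ Ideal.span {f} ⊔ Ideal.span (Set.range fun i : σ => X i - C (P i)) ^ k) :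
    ∃ d : 𝓞 K, d ≠ 0 ∧
      ∀ (L : Type v) [Field L] [Algebra K L] (Γ₀ : Type) [LinearOrderedCommGroupWithZero Γ₀]
        (v : Valuation L Γ₀), (∀ r : 𝓞 K, v (algebraMap (𝓞 K) L r) ≤ 1) →
        v (algebraMap (𝓞 K) L d) = 1 →
        ∀ y : σ → L, (∀ i, v (y i) ≤ 1) → aeval y f = 0 →
        ∀ μ : Γ₀, (∀ i, v (y i - algebraMap K L (P i)) ≤ μ) → v (aeval y R) ≤ μ ^ k := by
  classical
  obtain ⟨a, n, D, e, hRe⟩ := exists_sum_prod_of_mem_span_sup_pow f R P k hR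
  obtain ⟨d, hd0, hd⟩ := exists_den_coeff D
  refine ⟨d, hd0, ?_⟩
  intro L _ _ Γ₀ _ v hv hvd y hy hf μ hμ
  have hd1 : v (algebraMap K L (algebraMap (𝓞 K) K d)) = 1 := by
    rw [← IsScalarTower.algebraMap_apply]; exact hvd
  -- evaluate the representation at `y`
  have key : algebraMap K L (algebraMap (𝓞 K) K d) * aeval y R =
      ∑ j, aeval y (C (algebraMap (𝓞 K) K d) * D j) *
        ∏ l, (y (e j l) - algebraMap K L (P (e j l))) := by
    rw [hRe, map_add, map_mul, hf, mul_zero, zero_add, map_sum, Finset.mul_sum]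
    refine Finset.sum_congr rfl fun j _ => ?_
    rw [map_mul, map_mul, aeval_C, map_prod, mul_assoc]
    congr 2
    exact Finset.prod_congr rfl fun l _ => by simp [map_sub]
  have hval : v (aeval y R) = v (algebraMap K L (algebraMap (𝓞 K) K d) * aeval y R) := by
    rw [Valuation.map_mul, hd1, one_mul]
  rw [hval, key]
  refine Valuation.map_sum_le v fun j _ => ?_
  rw [Valuation.map_mul, map_prod]
  have hD : v (aeval y (C (algebraMap (𝓞 K) K d) * D j)) ≤ 1 := by
    refine valuation_aeval_le_one v _ (fun m => ?_) y hy
    obtain ⟨r, hr⟩ := hd j m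
    rw [coeff_C_mul, ← hr, ← IsScalarTower.algebraMap_apply]
    exact hv r
  calc v (aeval y (C (algebraMap (𝓞 K) K d) * D j)) *
        ∏ l, v (y (e j l) - algebraMap K L (P (e j l)))
      ≤ 1 * ∏ _l : Fin k, μ := mul_le_mul' hD (Finset.prod_le_prod' fun l _ => hμ (e j l))
    _ = μ ^ k := by rw [one_mul, Finset.prod_const, Finset.card_univ, Fintype.card_fin]

end Multiplicity

end Literature.NumberTheory.DiophantineGeometry.PlaneCurve
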